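import Summits.AtomisticToContinuum.Crystallization.Theorems.ChargedEnergyGapTwinTree

/-!
# `ChargedEnergyGap` — TWIN REDUCTION: free reduction of face words and the closure criterion «closed ⟺ the word cancels to nothing»
# (cell `decomp-a2c`, lens 3, generation 57, node «TwinTree», part P-E(3/3); over P-E(1/2) `…Theorems.ChargedEnergyGapTwinTree`;
# SUPPORT beneath (N𝄪) of part P-D `…Theorems.ChargedEnergyGapLocalTransfer`)

The edge lemma of P-E(1/2) says that a closed face word BACKTRACKS somewhere.  The induction «⇒ k faces through a genuine edge cannot
all be coherent Σ3» of memo g56 §2.1 peels one twin lamella (a pair of equal consecutive letters) at a time; this file types the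
engine of that induction — the FREE REDUCTION `twinReduce` of a face word in `(ℤ/2)^{*4}` (stack cancellation of equal neighbours) —
and the complete CLOSURE CRITERION: the product of the twin operations along ANY word is integral (in particular a cubic symmetry)
iff the word reduces to the empty word (`prod_map_twinRot_mem_iff_twinReduce_eq_nil`); the reduced word has the same product
(`prod_map_twinRot_twinReduce`), is non-backtracking (`isChain_twinReduce`), and deleting one lamella `… a a …` does not change it
(`twinReduce_append_cons_cons`).  SUPPORT, PROVED (0 sorry); no hypothesis, datum or dial; record and residual of record unchanged.
-/

open Matrix

namespace Summit.AtomisticToContinuum.Crystallization.Theorems.ChargedEnergyGapChartDial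

section TwinReduce

/-- One step of free reduction in `(ℤ/2)^{*4}`: push the letter `a` onto the reduced stack `r`, cancelling it against an equal top
letter (`R_a R_a = 1`). -/
def twinPush (a : Fin 4) : List (Fin 4) → List (Fin 4)
  | [] => [a]
  | b :: r => if a = b then r else a :: b :: r

/-- FREE REDUCTION of a face word: the normal form of `a₁ ⋯ aₙ` in `(ℤ/2)^{*4}` (remove twin lamellae `… a a …` until none is left). -/
def twinReduce : List (Fin 4) → List (Fin 4)
  | [] => []
  | a :: w => twinPush a (twinReduce w)

/-- `twinReduce` is the right fold of `twinPush`. -/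
theorem twinReduce_eq_foldr (w : List (Fin 4)) : twinReduce w = w.foldr twinPush [] := by
  induction w with
  | nil => rfl
  | cons a w ih => rw [twinReduce, List.foldr_cons, ih]

/-- Pushing a letter multiplies the product by its twin operation (a cancelled pair contributes `R_a R_a = 1`). -/
theorem prod_map_twinRot_twinPush (a : Fin 4) (r : List (Fin 4)) :
    ((twinPush a r).map twinRot).prod = twinRot a * (r.map twinRot).prod := by
  cases r with
  | nil => simp [twinPush]
  | cons b r =>
    by_cases hab : a = b
    · subst hab
      rw [twinPush, if_pos rfl, List.map_cons, List.prod_cons, ← mul_assoc, twinRot_mul_self, one_mul]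
    · rw [twinPush, if_neg hab, List.map_cons, List.prod_cons]

/-- ★ The reduced word has the SAME PRODUCT of twin operations. -/
theorem prod_map_twinRot_twinReduce (w : List (Fin 4)) :
    ((twinReduce w).map twinRot).prod = (w.map twinRot).prod := by
  induction w with
  | nil => rfl
  | cons a w ih => rw [twinReduce, prod_map_twinRot_twinPush, ih, List.map_cons, List.prod_cons]

/-- Pushing onto a non-backtracking stack keeps it non-backtracking. -/
theorem isChain_twinPush (a : Fin 4) {r : List (Fin 4)} (hr : r.IsChain (· ≠ ·)) : (twinPush a r).IsChain (· ≠ ·) := by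
  cases r with
  | nil => exact List.isChain_singleton a
  | cons b r =>
    by_cases hab : a = b
    · rw [twinPush, if_pos hab]; exact hr.tail
    · rw [twinPush, if_neg hab]; exact List.isChain_cons_cons.2 ⟨hab, hr⟩

/-- ★ The reduced word is NON-BACKTRACKING. -/
theorem isChain_twinReduce (w : List (Fin 4)) : (twinReduce w).IsChain (· ≠ ·) := by
  induction w with
  | nil => exact List.isChain_nil
  | cons a w ih => exact isChain_twinPush a ih

/-- ★★ CLOSURE CRITERION. The product of the twin operations along a face word is integral — in particular the orientation walk
closes modulo the cubic point group — iff the word FREELY REDUCES TO NOTHING (it is a nesting of twin lamellae). -/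
theorem prod_map_twinRot_mem_iff_twinReduce_eq_nil (w : List (Fin 4)) :
    (w.map twinRot).prod ∈ integralMatrices ↔ twinReduce w = [] := by
  constructor
  · intro h
    by_contra hne
    exact prod_map_twinRot_not_mem hne (isChain_twinReduce w) ((prod_map_twinRot_twinReduce w).symm ▸ h)
  · intro h
    rw [← prod_map_twinRot_twinReduce, h, List.map_nil, List.prod_nil]
    exact one_mem_integralMatrices

/-- The form with an explicit lattice symmetry `N`. -/
theorem twinReduce_eq_nil_of_prod_eq_mapMatrix {w : List (Fin 4)} (N : Matrix (Fin 3) (Fin 3) ℤ)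
    (h : (w.map twinRot).prod = (Int.castRingHom ℚ).mapMatrix N) : twinReduce w = [] :=
  (prod_map_twinRot_mem_iff_twinReduce_eq_nil w).1 (h ▸ mapMatrix_mem_integralMatrices N)

/-- Pushing the same letter twice onto a non-backtracking stack is the identity (`R_a R_a = 1` at the level of words). -/
theorem twinPush_twinPush (a : Fin 4) {r : List (Fin 4)} (hr : r.IsChain (· ≠ ·)) : twinPush a (twinPush a r) = r := by
  cases r with
  | nil => simp [twinPush]
  | cons b r =>
    by_cases hab : a = b
    · subst hab
      rw [twinPush, if_pos rfl]
      cases r with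
      | nil => rfl
      | cons c r =>
        have hac : a ≠ c := (List.isChain_cons_cons.1 hr).1
        rw [twinPush, if_neg hac]
    · rw [twinPush, if_neg hab, twinPush, if_pos rfl]

/-- Reduction of a concatenation: reduce the tail, then push the head letters. -/
theorem twinReduce_append (l₁ l₂ : List (Fin 4)) : twinReduce (l₁ ++ l₂) = l₁.foldr twinPush (twinReduce l₂) := by
  rw [twinReduce_eq_foldr, twinReduce_eq_foldr, List.foldr_append]

/-- ★ PEELING A LAMELLA: deleting one pair of equal consecutive letters does not change the reduced word — the engine of the
induction on the number of faces around an edge (memo g56 §2.1). -/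
theorem twinReduce_append_cons_cons (l₁ l₂ : List (Fin 4)) (a : Fin 4) :
    twinReduce (l₁ ++ a :: a :: l₂) = twinReduce (l₁ ++ l₂) := by
  rw [twinReduce_append, twinReduce_append, twinReduce, twinReduce, twinPush_twinPush a (isChain_twinReduce l₂)]

/-- The reduced word is never longer than the word. -/
theorem length_twinReduce_le (w : List (Fin 4)) : (twinReduce w).length ≤ w.length := by
  induction w with
  | nil => simp [twinReduce]
  | cons a w ih =>
    rw [twinReduce, List.length_cons]
    cases hw : twinReduce w with
    | nil => simp [twinPush]
    | cons b r =>
      rw [hw] at ih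
      by_cases hab : a = b
      · rw [twinPush, if_pos hab]; simp at ih; omega
      · rw [twinPush, if_neg hab]; simp at ih ⊢; omega

/-- A non-backtracking word is its own reduction … -/
theorem twinReduce_eq_self_of_isChain {w : List (Fin 4)} (hw : w.IsChain (· ≠ ·)) : twinReduce w = w := by
  induction w with
  | nil => rfl
  | cons a w ih =>
    cases w with
    | nil => rfl
    | cons b w =>
      obtain ⟨hab, hw'⟩ := List.isChain_cons_cons.1 hw
      rw [twinReduce, ih hw', twinPush, if_neg hab]

/-- … so reduction is idempotent: `twinReduce` is a normal form. -/
theorem twinReduce_twinReduce (w : List (Fin 4)) : twinReduce (twinReduce w) = twinReduce w :=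
  twinReduce_eq_self_of_isChain (isChain_twinReduce w)

end TwinReduce

end Summit.AtomisticToContinuum.Crystallization.Theorems.ChargedEnergyGapChartDial
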